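import Mathlib
import Summits.AtomisticToContinuum.HydrodynamicLimit.Theorems.ImplosionDichotomyDenseExcursionPackingAnalyticMajorantAnalytic

/-!
# From the structured source bound to the one-variable majorant recursion: the `G ≤ T/T₁` shift
# (crux `DenseExcursion`, stmt-AtomisticToContinuum-12586, line `sonic-cavity-renewal` v7, stub `stub_analyticPackingImplosion`)

Helper file (`--supports stmt-AtomisticToContinuum-12586`, line lead a2, wave-3 worker D; glue between
`packingSources_bound` (`…PackingAnalyticSourcesBound`) and `analytic_majorant_seeded` (`…PackingAnalyticMajorantSeeded`)).
The pointwise source bound is a TWO-variable majorant: explicit powers `Gʲ` (from the jet `m_j Gʲ` of the stiffening law)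
times powers of the majorant series `T(G) = Σ_{i≥1} T_i Gⁱ`, in the structured form
`Q·[Gᵏ]T² + 3(1+σ₂)·Σ_{p<k} [Gᵖ](1+T)² · Σ_{j≤k−p} |m_j|Φʲ [G^{k−p−j}](1+T)^{3j}`. The seeded majorant lemma wants
`Σ_{n=2}^{k} a_n [Gᵏ]Tⁿ` with GEOMETRIC `a_n`. Kernel-checked here, the classical shift `G ≤ T(G)/T₁` in the normalised
form `T₁ ≥ 1` (obtained by adding the seed `G` to `T`, i.e. `T₁ ↦ T₁ + 1`):

* `coeff_shift_le`: `[G^{k−j}] Tˡ ≤ [Gᵏ] T^{j+l}` for `T ≥ 0`, `T₀ = 0`, `T₁ ≥ 1` (`Gʲ ≤ Tʲ` coefficientwise);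
* `coeff_one_add_mk_pow`: `[Gᵖ](1+T)ᴺ = Σ_l C(N,l) [Gᵖ]Tˡ`; `coeff_mk_pow_eq_zero_of_lt`: `[Gᵏ]Tⁿ = 0` for `n > k`;
* `stiffening_double_sum`: `Σ_{p<k} [Gᵖ]U² Σ_{j≤k−p} w_j [G^{k−p−j}]U^{3j} = Σ_{1≤j≤k} w_j [G^{k−j}]U^{3j+2}` (the `j = 0`
  slice vanishes because `p = k` is excluded: no `X_k` on the right-hand side);
* `majorant_shift` (REGISTERED helper): for `k ≥ 2` the structured bound is `≤ Σ_{n ∈ Ico 2 (k+1)} a_n [Gᵏ]Tⁿ` with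
  `a_n = Q·[n=2] + 3(1+σ₂)M·((βΦ)ⁿ + Σ_{1≤j<n} (βΦ)ʲ C(3j+2, n−j))` when `|m_j| ≤ Mβʲ` — the lone term
  `j = k, l = 0` (the pure `Gᵏ` source `m_k Φᵏ…`) is placed on `[Gᵏ]Tᵏ ≥ T₁ᵏ ≥ 1`, every other term has `j + l ≥ 2`;
* `majorant_shift_coeff_le`: `0 ≤ a_n ≤ (Q + 15(1+σ₂)M)·(max 2 (16βΦ))ⁿ` — the geometric hypothesis of
  `analytic_majorant_seeded`.

Pure combinatorics over Mathlib's `PowerSeries` (`add_pow`, `coeff_X_pow_mul'`, `X_pow_dvd_iff`). NOT here: norms or `Γ`.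
-/

noncomputable section

open Finset PowerSeries

namespace Summit.AtomisticToContinuum.HydrodynamicLimit.Theorems.PackingAnalyticImplosion

/-! ## Coefficientwise comparison tools -/

/-- Nonnegativity of the coefficients of powers of a nonnegative series. [folklore] -/
theorem coeff_mk_pow_nonneg {T : ℕ → ℝ} (hT : ∀ i, 0 ≤ T i) (l d : ℕ) : 0 ≤ coeff d ((PowerSeries.mk T) ^ l) :=
  (coeff_pow_mono (t := T) (c := T) (j := d) (fun i _ => ⟨hT i, le_rfl⟩) l d le_rfl).1

/-- Multiplication by a series with nonnegative coefficients preserves coefficientwise `≤`. [folklore] -/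
theorem coeff_mul_le_of_le {φ ψ χ : PowerSeries ℝ} {k : ℕ} (hχ : ∀ i, 0 ≤ coeff i χ)
    (h : ∀ i, i ≤ k → coeff i φ ≤ coeff i ψ) : coeff k (φ * χ) ≤ coeff k (ψ * χ) := by
  rw [coeff_mul, coeff_mul]
  refine sum_le_sum fun p hp => ?_
  have hpk : p.1 ≤ k := by
    have := Finset.HasAntidiagonal.mem_antidiagonal.mp hp; omega
  exact mul_le_mul_of_nonneg_right (h p.1 hpk) (hχ p.2)

/-- `G · χ ≤ T · χ` coefficientwise for `χ ≥ 0`, `T ≥ 0`, `T₁ ≥ 1`. [folklore] -/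
theorem coeff_X_mul_le {T : ℕ → ℝ} (hT : ∀ i, 0 ≤ T i) (hT1 : 1 ≤ T 1) {χ : PowerSeries ℝ}
    (hχ : ∀ i, 0 ≤ coeff i χ) (k : ℕ) : coeff k (X * χ) ≤ coeff k (PowerSeries.mk T * χ) := by
  refine coeff_mul_le_of_le hχ fun i _ => ?_
  rw [coeff_X, coeff_mk]
  split_ifs with h
  · rw [h]; exact hT1
  · exact hT i

/-- `Gʲ · Tˡ ≤ T^{j+l}` coefficientwise (`T ≥ 0`, `T₁ ≥ 1`). [folklore] -/
theorem coeff_X_pow_mul_pow_le {T : ℕ → ℝ} (hT : ∀ i, 0 ≤ T i) (hT1 : 1 ≤ T 1) :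
    ∀ j l k : ℕ, coeff k (X ^ j * (PowerSeries.mk T) ^ l) ≤ coeff k ((PowerSeries.mk T) ^ (j + l)) := by
  intro j
  induction j with
  | zero => intro l k; simp
  | succ j ih =>
    intro l k
    -- `X^{j+1} T^l = X^j (X T^l) ≤ X^j T^{l+1}`? we go through `X^j (T^{l}) ` then one more `X ≤ T`
    have h1 : coeff k (X ^ (j + 1) * (PowerSeries.mk T) ^ l) = coeff k (X * (X ^ j * (PowerSeries.mk T) ^ l)) := by
      ring_nf
    have h2 : coeff k (X * (X ^ j * (PowerSeries.mk T) ^ l)) ≤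
        coeff k (PowerSeries.mk T * (X ^ j * (PowerSeries.mk T) ^ l)) := by
      refine coeff_X_mul_le hT hT1 (fun i => ?_) k
      rw [coeff_X_pow_mul']
      split_ifs
      · exact coeff_mk_pow_nonneg hT _ _
      · exact le_rfl
    have h3 : coeff k (PowerSeries.mk T * (X ^ j * (PowerSeries.mk T) ^ l)) =
        coeff k (X ^ j * (PowerSeries.mk T) ^ (l + 1)) := by ring_nf
    have h4 := ih (l + 1) k
    rw [show j + (l + 1) = j + 1 + l by ring] at h4
    linarith

/-- THE SHIFT: `[G^{k−j}] Tˡ ≤ [Gᵏ] T^{j+l}` for `j ≤ k` (`T ≥ 0`, `T₁ ≥ 1`). [folklore] -/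
theorem coeff_shift_le {T : ℕ → ℝ} (hT : ∀ i, 0 ≤ T i) (hT1 : 1 ≤ T 1) {j k : ℕ} (hjk : j ≤ k) (l : ℕ) :
    coeff (k - j) ((PowerSeries.mk T) ^ l) ≤ coeff k ((PowerSeries.mk T) ^ (j + l)) := by
  have h := coeff_X_pow_mul_pow_le hT hT1 j l k
  rwa [coeff_X_pow_mul', if_pos hjk] at h

/-- The binomial expansion on coefficients: `[Gᵖ](1+T)ᴺ = Σ_{l≤N} C(N,l) [Gᵖ]Tˡ`. [folklore] -/
theorem coeff_one_add_mk_pow (T : ℕ → ℝ) (N p : ℕ) :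
    coeff p ((1 + PowerSeries.mk T) ^ N) =
      ∑ l ∈ range (N + 1), (N.choose l : ℝ) * coeff p ((PowerSeries.mk T) ^ l) := by
  rw [add_comm, add_pow, map_sum]
  refine sum_congr rfl fun l _ => ?_
  rw [one_pow, mul_one, mul_comm, ← map_natCast (PowerSeries.C) (N.choose l), coeff_C_mul]

/-- `[Gᵏ] Tⁿ = 0` for `n > k` when `T₀ = 0`. [folklore] -/
theorem coeff_mk_pow_eq_zero_of_lt {T : ℕ → ℝ} (hT0 : T 0 = 0) {n k : ℕ} (h : k < n) :
    coeff k ((PowerSeries.mk T) ^ n) = 0 := by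
  have hX : (X : PowerSeries ℝ) ∣ PowerSeries.mk T := by
    rw [X_dvd_iff]; simpa using hT0
  have hXn : (X : PowerSeries ℝ) ^ n ∣ (PowerSeries.mk T) ^ n := pow_dvd_pow_of_dvd hX n
  exact (X_pow_dvd_iff.mp hXn) k h

/-! ## The double sum of the stiffening terms -/

/-- Coefficient of a product as a `range` sum. [folklore] -/
theorem coeff_mul_range (φ ψ : PowerSeries ℝ) (n : ℕ) :
    coeff n (φ * ψ) = ∑ p ∈ range (n + 1), coeff p φ * coeff (n - p) ψ := by
  rw [coeff_mul, Nat.sum_antidiagonal_eq_sum_range_succ (fun p q => coeff p φ * coeff q ψ) n]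

/-- REINDEXING THE STIFFENING TERMS: `Σ_{p<k} [Gᵖ]U² · Σ_{j≤k−p} w_j [G^{k−p−j}]U^{3j} = Σ_{1≤j≤k} w_j [G^{k−j}]U^{3j+2}`
for any series `U` and weights `w` (the `j = 0` slice vanishes: it would need `p = k`). [folklore] -/
theorem stiffening_double_sum (U : PowerSeries ℝ) (w : ℕ → ℝ) (k : ℕ) :
    ∑ p ∈ range k, coeff p (U ^ 2) * ∑ j ∈ range (k - p + 1), w j * coeff (k - p - j) (U ^ (3 * j)) =
      ∑ j ∈ Ico 1 (k + 1), w j * coeff (k - j) (U ^ (3 * j + 2)) := by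
  -- swap the sums over the triangle `{(p, j) : p < k, j ≤ k − p}`
  have hswap : ∑ p ∈ range k, ∑ j ∈ range (k - p + 1), coeff p (U ^ 2) * (w j * coeff (k - p - j) (U ^ (3 * j))) =
      ∑ j ∈ range (k + 1), ∑ p ∈ (if j = 0 then range k else range (k - j + 1)),
        coeff p (U ^ 2) * (w j * coeff (k - p - j) (U ^ (3 * j))) := by
    refine Finset.sum_comm' fun p j => ?_
    constructor
    · rintro ⟨hp, hj⟩
      rw [mem_range] at hp hj
      refine ⟨?_, mem_range.mpr (by omega)⟩
      split_ifs with h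
      · exact mem_range.mpr hp
      · exact mem_range.mpr (by omega)
    · rintro ⟨hp, hj⟩
      rw [mem_range] at hj
      split_ifs at hp with h
      · rw [mem_range] at hp
        exact ⟨mem_range.mpr hp, mem_range.mpr (by omega)⟩
      · rw [mem_range] at hp
        exact ⟨mem_range.mpr (by omega), mem_range.mpr (by omega)⟩
  simp_rw [mul_sum]
  rw [hswap, range_eq_Ico, sum_eq_sum_Ico_succ_bot (by omega : 0 < k + 1)]
  -- the `j = 0` slice vanishes
  have h0 : ∑ p ∈ (if (0:ℕ) = 0 then range k else range (k - 0 + 1)),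
      coeff p (U ^ 2) * (w 0 * coeff (k - p - 0) (U ^ (3 * 0))) = 0 := by
    rw [if_pos rfl]
    refine sum_eq_zero fun p hp => ?_
    rw [mem_range] at hp
    rw [mul_zero, pow_zero, coeff_one, Nat.sub_zero, if_neg (by omega)]
    ring
  rw [h0, zero_add]
  refine sum_congr rfl fun j hj => ?_
  rw [mem_Ico] at hj
  rw [if_neg (by omega), pow_add, mul_comm (U ^ (3 * j)) (U ^ 2), coeff_mul_range, mul_sum]
  refine sum_congr rfl fun p _ => ?_
  rw [show k - p - j = k - j - p by omega]
  ring

/-! ## The shift itself -/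

/-- **THE MAJORANT SHIFT** (registered helper `majorant_shift` of `stub_analyticPackingImplosion`): for `k ≥ 2`,
`T₀ = 0`, `T ≥ 0`, `T₁ ≥ 1` and a jet `|m_j| ≤ Mβʲ`, the structured source bound of `packingSources_bound` is dominated
by the one-variable majorant polynomial `Σ_{n ∈ Ico 2 (k+1)} a_n [Gᵏ]Tⁿ` with the `k`-INDEPENDENT coefficients
`a_n = Q[n=2] + 3(1+σ₂)M((βΦ)ⁿ + Σ_{1≤j<n} (βΦ)ʲ C(3j+2, n−j))`, `Q = 9 + 3σ₂ + σ₁`. [folklore] -/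
theorem majorant_shift : ∀ (T m a : ℕ → ℝ) (σ₁ σ₂ Φ M β : ℝ) (k : ℕ), T 0 = 0 → (∀ i, 0 ≤ T i) → 1 ≤ T 1 → 0 ≤ σ₁ → 0 ≤ σ₂ → 0 ≤ Φ → 0 ≤ M → 0 ≤ β → (∀ j, |m j| ≤ M * β ^ j) → 2 ≤ k → (∀ n, a n = (9 + 3 * σ₂ + σ₁) * (if n = 2 then 1 else 0) + 3 * (1 + σ₂) * M * ((β * Φ) ^ n + ∑ j ∈ Finset.Ico 1 n, (β * Φ) ^ j * ((3 * j + 2).choose (n - j) : ℝ))) → (9 + 3 * σ₂ + σ₁) * PowerSeries.coeff k (PowerSeries.mk T ^ 2) + 3 * (1 + σ₂) * ∑ p ∈ Finset.range k, PowerSeries.coeff p ((1 + PowerSeries.mk T) ^ 2) * ∑ j ∈ Finset.range (k - p + 1), |m j| * Φ ^ j * PowerSeries.coeff (k - p - j) ((1 + PowerSeries.mk T) ^ (3 * j)) ≤ ∑ n ∈ Finset.Ico 2 (k + 1), a n * PowerSeries.coeff k (PowerSeries.mk T ^ n) := by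
  intro T m a σ₁ σ₂ Φ M β k hT0 hT hT1 hσ₁ hσ₂ hΦ hM hβ hm hk ha
  set Q : ℝ := 9 + 3 * σ₂ + σ₁ with hQ
  set γ : ℝ := β * Φ with hγ
  set L : ℝ := 3 * (1 + σ₂) * M with hL
  have hQ0 : 0 ≤ Q := by rw [hQ]; positivity
  have hγ0 : 0 ≤ γ := by rw [hγ]; positivity
  have hL0 : 0 ≤ L := by rw [hL]; positivity
  have hc0 : ∀ n d, 0 ≤ coeff d ((PowerSeries.mk T) ^ n) := fun n d => coeff_mk_pow_nonneg hT n d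
  -- Step 1: the stiffening double sum, reindexed and with `|m_j| Φ^j ≤ M γ^j`
  have hw : ∀ j, |m j| * Φ ^ j ≤ M * γ ^ j := fun j => by
    rw [hγ, mul_pow, ← mul_assoc]
    exact mul_le_mul_of_nonneg_right (hm j) (pow_nonneg hΦ j)
  have step1 : ∑ p ∈ range k, coeff p ((1 + PowerSeries.mk T) ^ 2) *
      ∑ j ∈ range (k - p + 1), |m j| * Φ ^ j * coeff (k - p - j) ((1 + PowerSeries.mk T) ^ (3 * j)) ≤
      ∑ j ∈ Ico 1 (k + 1), M * γ ^ j * coeff (k - j) ((1 + PowerSeries.mk T) ^ (3 * j + 2)) := by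
    rw [stiffening_double_sum (1 + PowerSeries.mk T) (fun j => |m j| * Φ ^ j) k]
    refine sum_le_sum fun j _ => mul_le_mul_of_nonneg_right (hw j) ?_
    rw [coeff_one_add_mk_pow]
    exact sum_nonneg fun l _ => mul_nonneg (Nat.cast_nonneg _) (hc0 l _)
  -- Step 2: expand `(1+T)^{3j+2}`, shift `G^j T^l ≤ T^{j+l}` for `l ≥ 1`, and treat `l = 0` (only `j = k`) apart
  have step2 : ∀ j, 1 ≤ j → j ≤ k → coeff (k - j) ((1 + PowerSeries.mk T) ^ (3 * j + 2)) ≤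
      (if j = k then 1 else 0) + ∑ l ∈ Ico 1 (3 * j + 3), ((3 * j + 2).choose l : ℝ) *
        coeff k ((PowerSeries.mk T) ^ (j + l)) := by
    intro j hj1 hjk
    rw [coeff_one_add_mk_pow, range_eq_Ico, sum_eq_sum_Ico_succ_bot (by omega : 0 < 3 * j + 2 + 1),
      show 3 * j + 2 + 1 = 3 * j + 3 by ring]
    refine add_le_add ?_ (sum_le_sum fun l _ => mul_le_mul_of_nonneg_left (coeff_shift_le hT hT1 hjk l)
      (Nat.cast_nonneg _))
    -- the `l = 0` term: `C(·,0) [G^{k−j}] 1 = [j = k]`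
    rw [Nat.choose_zero_right, Nat.cast_one, one_mul, pow_zero, coeff_one]
    split_ifs <;> first | exact le_rfl | (exfalso; omega)
  -- Step 3: collect by the exponent `n = j + l`
  have key : ∑ j ∈ Ico 1 (k + 1), γ ^ j * coeff (k - j) ((1 + PowerSeries.mk T) ^ (3 * j + 2)) ≤
      γ ^ k * coeff k ((PowerSeries.mk T) ^ k) + ∑ j ∈ Ico 1 (k + 1), ∑ l ∈ Ico 1 (3 * j + 3),
        γ ^ j * ((3 * j + 2).choose l : ℝ) * coeff k ((PowerSeries.mk T) ^ (j + l)) := by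
    have h1 : ∑ j ∈ Ico 1 (k + 1), γ ^ j * coeff (k - j) ((1 + PowerSeries.mk T) ^ (3 * j + 2)) ≤
        ∑ j ∈ Ico 1 (k + 1), (γ ^ j * (if j = k then 1 else 0) + ∑ l ∈ Ico 1 (3 * j + 3),
          γ ^ j * ((3 * j + 2).choose l : ℝ) * coeff k ((PowerSeries.mk T) ^ (j + l))) := by
      refine sum_le_sum fun j hj => ?_
      rw [mem_Ico] at hj
      have h := mul_le_mul_of_nonneg_left (step2 j hj.1 (by omega)) (pow_nonneg hγ0 j)
      rw [mul_add, mul_sum] at h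
      refine h.trans (le_of_eq ?_)
      congr 1
      refine sum_congr rfl fun l _ => ?_
      ring
    have h2 : ∑ j ∈ Ico 1 (k + 1), (γ ^ j * (if j = k then 1 else 0) + ∑ l ∈ Ico 1 (3 * j + 3),
          γ ^ j * ((3 * j + 2).choose l : ℝ) * coeff k ((PowerSeries.mk T) ^ (j + l))) =
        γ ^ k + ∑ j ∈ Ico 1 (k + 1), ∑ l ∈ Ico 1 (3 * j + 3),
          γ ^ j * ((3 * j + 2).choose l : ℝ) * coeff k ((PowerSeries.mk T) ^ (j + l)) := by
      rw [sum_add_distrib]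
      congr 1
      have e : ∀ j ∈ Ico 1 (k + 1), γ ^ j * (if j = k then (1:ℝ) else 0) = if j = k then γ ^ j else 0 := by
        intro j _; split_ifs <;> simp
      rw [sum_congr rfl e, sum_ite_eq' (Ico 1 (k + 1)) k (fun j => γ ^ j), if_pos (mem_Ico.mpr ⟨by omega, by omega⟩)]
    have h3 : (1:ℝ) ≤ coeff k ((PowerSeries.mk T) ^ k) := by
      have h := coeff_shift_le hT hT1 (le_refl k) 0
      rw [Nat.sub_self, pow_zero, coeff_one, if_pos rfl, add_zero] at h
      exact h
    have h4 : γ ^ k ≤ γ ^ k * coeff k ((PowerSeries.mk T) ^ k) := le_mul_of_one_le_right (pow_nonneg hγ0 k) h3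
    linarith
  have step3 : Q * coeff k ((PowerSeries.mk T) ^ 2) + 3 * (1 + σ₂) *
      ∑ j ∈ Ico 1 (k + 1), M * γ ^ j * coeff (k - j) ((1 + PowerSeries.mk T) ^ (3 * j + 2)) ≤
      Q * coeff k ((PowerSeries.mk T) ^ 2) + L * γ ^ k * coeff k ((PowerSeries.mk T) ^ k) +
        L * ∑ j ∈ Ico 1 (k + 1), ∑ l ∈ Ico 1 (3 * j + 3), γ ^ j * ((3 * j + 2).choose l : ℝ) *
          coeff k ((PowerSeries.mk T) ^ (j + l)) := by
    have e : 3 * (1 + σ₂) * ∑ j ∈ Ico 1 (k + 1), M * γ ^ j * coeff (k - j) ((1 + PowerSeries.mk T) ^ (3 * j + 2)) =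
        L * ∑ j ∈ Ico 1 (k + 1), γ ^ j * coeff (k - j) ((1 + PowerSeries.mk T) ^ (3 * j + 2)) := by
      rw [hL, mul_sum, mul_sum]
      refine sum_congr rfl fun j _ => ?_
      ring
    rw [e]
    have h := mul_le_mul_of_nonneg_left key hL0
    linarith
  -- Step 4: the right-hand side of step 3 is a sub-sum of `Σ_{n ∈ Ico 2 (k+1)} a n [G^k] T^n`
  set c : ℕ → ℝ := fun n => coeff k ((PowerSeries.mk T) ^ n) with hcdef
  have hcn : ∀ n, 0 ≤ c n := fun n => hc0 n k
  have hczero : ∀ n, k < n → c n = 0 := fun n hn => coeff_mk_pow_eq_zero_of_lt hT0 hn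
  -- (iii) the double sum regrouped by `n = j + l`
  have hD : ∑ j ∈ Ico 1 (k + 1), ∑ l ∈ Ico 1 (3 * j + 3), γ ^ j * ((3 * j + 2).choose l : ℝ) * c (j + l) ≤
      ∑ n ∈ Ico 2 (k + 1), (∑ j ∈ Ico 1 n, γ ^ j * ((3 * j + 2).choose (n - j) : ℝ)) * c n := by
    -- right-hand side in `(j, l)` indexing
    have hR : ∑ n ∈ Ico 2 (k + 1), (∑ j ∈ Ico 1 n, γ ^ j * ((3 * j + 2).choose (n - j) : ℝ)) * c n =
        ∑ j ∈ Ico 1 (k + 1), ∑ l ∈ Ico 1 (k - j + 1), γ ^ j * ((3 * j + 2).choose l : ℝ) * c (j + l) := by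
      simp_rw [sum_mul]
      rw [Finset.sum_comm' (t' := Ico 1 (k + 1)) (s' := fun j => Ico (j + 1) (k + 1))]
      · refine sum_congr rfl fun j hj => ?_
        rw [mem_Ico] at hj
        have hI : Ico (j + 1) (k + 1) = (Ico 1 (k - j + 1)).map (addRightEmbedding j) := by
          rw [Finset.map_add_right_Ico]; congr 1 <;> omega
        rw [hI, Finset.sum_map]
        refine sum_congr rfl fun l _ => ?_
        simp only [addRightEmbedding_apply]
        rw [show l + j - j = l by omega, add_comm l j]
      · intro n j
        simp only [mem_Ico]
        omega
    rw [hR]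
    refine sum_le_sum fun j hj => ?_
    rw [mem_Ico] at hj
    -- drop the vanishing terms `l > k − j`, then enlarge the index set
    have hz : ∑ l ∈ Ico 1 (3 * j + 3), γ ^ j * ((3 * j + 2).choose l : ℝ) * c (j + l) =
        ∑ l ∈ (Ico 1 (3 * j + 3)).filter (fun l => l ≤ k - j), γ ^ j * ((3 * j + 2).choose l : ℝ) * c (j + l) := by
      rw [sum_filter]
      refine sum_congr rfl fun l _ => ?_
      split_ifs with h
      · rfl
      · rw [hczero (j + l) (by omega), mul_zero]
    rw [hz]
    refine sum_le_sum_of_subset_of_nonneg (fun l hl => ?_) fun l _ _ =>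
      mul_nonneg (mul_nonneg (pow_nonneg hγ0 _) (Nat.cast_nonneg _)) (hcn _)
    rw [mem_filter, mem_Ico] at hl
    rw [mem_Ico]; omega
  -- the target sum split in three
  have hsplit : ∑ n ∈ Ico 2 (k + 1), a n * c n =
      Q * c 2 + ∑ n ∈ Ico 2 (k + 1), L * γ ^ n * c n +
        L * ∑ n ∈ Ico 2 (k + 1), (∑ j ∈ Ico 1 n, γ ^ j * ((3 * j + 2).choose (n - j) : ℝ)) * c n := by
    have e1 : ∑ n ∈ Ico 2 (k + 1), a n * c n =
        ∑ n ∈ Ico 2 (k + 1), ((if n = 2 then Q * c n else 0) + (L * γ ^ n * c n +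
          L * ((∑ j ∈ Ico 1 n, γ ^ j * ((3 * j + 2).choose (n - j) : ℝ)) * c n))) := by
      refine sum_congr rfl fun n _ => ?_
      rw [ha n]
      split_ifs <;> ring
    rw [e1, sum_add_distrib, sum_add_distrib, sum_ite_eq' (Ico 2 (k + 1)) 2 (fun n => Q * c n),
      if_pos (mem_Ico.mpr ⟨le_rfl, by omega⟩), ← mul_sum]
    ring
  have hS2 : L * γ ^ k * c k ≤ ∑ n ∈ Ico 2 (k + 1), L * γ ^ n * c n :=
    single_le_sum (f := fun n => L * γ ^ n * c n) (fun n _ => mul_nonneg (mul_nonneg hL0 (pow_nonneg hγ0 _)) (hcn n))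
      (mem_Ico.mpr ⟨hk, by omega⟩)
  have step4 : Q * c 2 + L * γ ^ k * c k +
      L * ∑ j ∈ Ico 1 (k + 1), ∑ l ∈ Ico 1 (3 * j + 3), γ ^ j * ((3 * j + 2).choose l : ℝ) * c (j + l) ≤
      ∑ n ∈ Ico 2 (k + 1), a n * c n := by
    rw [hsplit]
    have h3 := mul_le_mul_of_nonneg_left hD hL0
    linarith
  -- conclude
  calc (9 + 3 * σ₂ + σ₁) * coeff k ((PowerSeries.mk T) ^ 2) + 3 * (1 + σ₂) *
        ∑ p ∈ range k, coeff p ((1 + PowerSeries.mk T) ^ 2) *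
          ∑ j ∈ range (k - p + 1), |m j| * Φ ^ j * coeff (k - p - j) ((1 + PowerSeries.mk T) ^ (3 * j))
      ≤ Q * coeff k ((PowerSeries.mk T) ^ 2) + 3 * (1 + σ₂) *
          ∑ j ∈ Ico 1 (k + 1), M * γ ^ j * coeff (k - j) ((1 + PowerSeries.mk T) ^ (3 * j + 2)) := by
        rw [hQ]
        have : 0 ≤ 3 * (1 + σ₂) := by positivity
        nlinarith [step1]
    _ ≤ Q * coeff k ((PowerSeries.mk T) ^ 2) + L * γ ^ k * coeff k ((PowerSeries.mk T) ^ k) +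
        L * ∑ j ∈ Ico 1 (k + 1), ∑ l ∈ Ico 1 (3 * j + 3), γ ^ j * ((3 * j + 2).choose l : ℝ) *
          coeff k ((PowerSeries.mk T) ^ (j + l)) := step3
    _ ≤ ∑ n ∈ Ico 2 (k + 1), a n * coeff k ((PowerSeries.mk T) ^ n) := step4

/-- The shifted coefficients are nonnegative and GEOMETRIC: `a_n ≤ (Q + 15(1+σ₂)M)(max 2 (16βΦ))ⁿ` — the hypothesis
`a m ≤ A αᵐ` of `analytic_majorant_seeded`. [folklore] -/
theorem majorant_shift_coeff_le : ∀ (a : ℕ → ℝ) (σ₁ σ₂ Φ M β : ℝ), 0 ≤ σ₁ → 0 ≤ σ₂ → 0 ≤ Φ → 0 ≤ M → 0 ≤ β →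
    (∀ n, a n = (9 + 3 * σ₂ + σ₁) * (if n = 2 then 1 else 0) + 3 * (1 + σ₂) * M *
      ((β * Φ) ^ n + ∑ j ∈ Finset.Ico 1 n, (β * Φ) ^ j * ((3 * j + 2).choose (n - j) : ℝ))) →
    ∀ n, 0 ≤ a n ∧ a n ≤ (9 + 3 * σ₂ + σ₁ + 15 * (1 + σ₂) * M) * (max 2 (16 * (β * Φ))) ^ n := by
  intro a σ₁ σ₂ Φ M β hσ₁ hσ₂ hΦ hM hβ ha n
  set γ : ℝ := β * Φ with hγ
  set ρ : ℝ := max 2 (16 * γ) with hρ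
  have hγ0 : 0 ≤ γ := by rw [hγ]; positivity
  have hρ2 : 2 ≤ ρ := le_max_left _ _
  have hρ1 : 1 ≤ ρ := by linarith
  have hργ : 16 * γ ≤ ρ := le_max_right _ _
  have hsum0 : 0 ≤ ∑ j ∈ Ico 1 n, γ ^ j * ((3 * j + 2).choose (n - j) : ℝ) :=
    sum_nonneg fun j _ => mul_nonneg (pow_nonneg hγ0 _) (Nat.cast_nonneg _)
  have hind : (0:ℝ) ≤ (if n = 2 then 1 else 0) ∧ (if n = 2 then (1:ℝ) else 0) ≤ 1 := by
    split_ifs <;> norm_num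
  constructor
  · rw [ha n]
    have h1 : 0 ≤ (9 + 3 * σ₂ + σ₁) * (if n = 2 then (1:ℝ) else 0) := mul_nonneg (by positivity) hind.1
    have h2 : 0 ≤ 3 * (1 + σ₂) * M * (γ ^ n + ∑ j ∈ Ico 1 n, γ ^ j * ((3 * j + 2).choose (n - j) : ℝ)) :=
      mul_nonneg (by positivity) (add_nonneg (pow_nonneg hγ0 _) hsum0)
    linarith
  · rw [ha n]
    -- `γ^n ≤ ρ^n`, `Σ_{j<n} γ^j C(3j+2, n-j) ≤ Σ_j γ^j 8^j 4 ≤ 4 n (ρ/2)^n ≤ 4 ρ^n`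
    have hγρ : γ ^ n ≤ ρ ^ n := pow_le_pow_left₀ hγ0 (by linarith) n
    have hterm : ∀ j ∈ Ico 1 n, γ ^ j * ((3 * j + 2).choose (n - j) : ℝ) ≤ 4 * (ρ / 2) ^ n := by
      intro j hj
      rw [mem_Ico] at hj
      have hch : ((3 * j + 2).choose (n - j) : ℝ) ≤ 2 ^ (3 * j + 2) := by
        exact_mod_cast Nat.choose_le_two_pow (3 * j + 2) (n - j)
      have h8 : γ ^ j * (2:ℝ) ^ (3 * j + 2) = 4 * (8 * γ) ^ j := by
        rw [pow_add, pow_mul, mul_pow]; norm_num; ring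
      have h8γ : (8 * γ) ^ j ≤ (ρ / 2) ^ j := pow_le_pow_left₀ (by positivity) (by linarith) j
      have hρj : (ρ / 2) ^ j ≤ (ρ / 2) ^ n := pow_le_pow_right₀ (by linarith) (by omega)
      calc γ ^ j * ((3 * j + 2).choose (n - j) : ℝ) ≤ γ ^ j * 2 ^ (3 * j + 2) :=
            mul_le_mul_of_nonneg_left hch (pow_nonneg hγ0 _)
        _ = 4 * (8 * γ) ^ j := h8
        _ ≤ 4 * (ρ / 2) ^ n := by nlinarith
    have hsum : ∑ j ∈ Ico 1 n, γ ^ j * ((3 * j + 2).choose (n - j) : ℝ) ≤ 4 * ρ ^ n := by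
      calc ∑ j ∈ Ico 1 n, γ ^ j * ((3 * j + 2).choose (n - j) : ℝ) ≤ ∑ j ∈ Ico 1 n, 4 * (ρ / 2) ^ n :=
            sum_le_sum hterm
        _ = (n - 1 : ℕ) * (4 * (ρ / 2) ^ n) := by rw [sum_const, Nat.card_Ico, nsmul_eq_mul]
        _ ≤ 4 * ((n : ℝ) * (ρ / 2) ^ n) := by
            have : ((n - 1 : ℕ) : ℝ) ≤ n := by exact_mod_cast Nat.sub_le n 1
            have h0 : 0 ≤ (ρ / 2) ^ n := pow_nonneg (by linarith) n
            nlinarith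
        _ ≤ 4 * ρ ^ n := by
            have hn2 : (n : ℝ) ≤ 2 ^ n := by exact_mod_cast Nat.lt_two_pow_self.le
            have e : ρ ^ n = 2 ^ n * (ρ / 2) ^ n := by rw [← mul_pow]; congr 1; ring
            rw [e]
            have h0 : 0 ≤ (ρ / 2) ^ n := pow_nonneg (by linarith) n
            nlinarith
    have hone : (1:ℝ) ≤ ρ ^ n := one_le_pow₀ hρ1
    have hQ0 : 0 ≤ 9 + 3 * σ₂ + σ₁ := by positivity
    have hL0 : 0 ≤ 3 * (1 + σ₂) * M := by positivity
    calc (9 + 3 * σ₂ + σ₁) * (if n = 2 then 1 else 0) + 3 * (1 + σ₂) * M *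
          (γ ^ n + ∑ j ∈ Ico 1 n, γ ^ j * ((3 * j + 2).choose (n - j) : ℝ))
        ≤ (9 + 3 * σ₂ + σ₁) * ρ ^ n + 3 * (1 + σ₂) * M * (ρ ^ n + 4 * ρ ^ n) := by
          gcongr
          exact hind.2.trans hone
      _ = (9 + 3 * σ₂ + σ₁ + 15 * (1 + σ₂) * M) * ρ ^ n := by ring

end Summit.AtomisticToContinuum.HydrodynamicLimit.Theorems.PackingAnalyticImplosion

end
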